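import Mathlib
import Summits.Ventures.PercRepro2.TypedLocusBridge4

/-!
# The class-level cut rule of the typed equality locus (blind cell PercRepro2, mine-2 g38,
2026-08-28; `proofs/MINE2-CUTRULE.md`, row M2-78)

`typedCount_eq_zero_of_blocks'''` (TypedLocusBridge4) vanishes a typed count of `K₃` under
hypotheses stated fibre by fibre (for every PD spectator `x`).  This file gives a hypothesis on
the CLASS — the graph, the typed set `F`, the types `τ` and the pinning `z` — that implies them,
so that whole families are theorem-zeros without a fibre check.

The device is the **cut rule**: call `u` *cut-attached* relative to a set `B` of vertices
(`CutAttached`) when every vertex set `U ∋ u` avoiding `B` has its *cut configuration*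
(`cutCfg U`: the forced edges — typed of type `2`, or pinned open off `F` — crossing `U`) joining
two of `a₁, a₂, a₃`.  In a spectator `x` with `Q ∧ PD` every forced edge crossing the
`specPin`-component `U₀` of `u` is OPEN in `x` (a closed forced edge is open in `specPin` and
could not cross `U₀`), so `cutCfg U₀ ≤ x` and `x` would join two of `a₁, a₂, a₃` — impossible;
hence `U₀` meets `B` (`conn_of_cutAttached`).  With `B = {a₁, a₂}` this is attachment of `u`
in every PD spectator's forced-open configuration; with `B = {a₁, a₂, a₃}` it is attachment
once `a₃` is attached.

**`typedCount_eq_zero_of_cutRule`**: if `a₃` is cut-attached relative to `{a₁, a₂}` (this is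
`H3`) and `b` or `o` is cut-attached relative to `{a₁, a₂, a₃}`, or every neighbour of `b` along
a live edge (typed, or pinned open) is, then the typed count of `K₃` vanishes: the first two
alternatives are the `b`-attached / `o`-attached alternatives of `blocks'''`, the third makes
`W = {b}` a block of the `b`-kind on every fibre in which `b` is not attached.  On g37's census
(1,090 seven-vertex graphs, m = 10 … 14) the class hypothesis holds on 68,252 of the 88,132
classes on which the fibre hypothesis of `blocks'''` holds (`code/cutrule.py`; the 1388322-type
two-edge rule is the special case in which every neighbour of `b` has type-2 edges to two
distinct vertices of `{a₁, a₂, a₃}`).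

Own code; standard axioms.
-/

namespace Summit.Ventures.PercRepro2

open UnionCluster

namespace CovForm

namespace LocusBridge

open OneTyped TypedA3 BlockTransfer

section CutRule

open Classical

variable {V : Type*} {E : Type*} [Fintype E] [DecidableEq E] {R : Type*} [Field R]
  [LinearOrder R] [IsStrictOrderedRing R]
variable (ends : E → Sym2 V) (a₁ a₂ a₃ : V)

/-- The cut configuration of a vertex set `U`: the forced edges (typed of type `2`, or pinned open
off `F`) with one endpoint in `U` and one outside. -/
noncomputable def cutCfg (F : Finset E) (z : Config E) (τ : E → ℕ) (U : Set V) : Config E :=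
  fun e => decide ((∃ v ∈ U, v ∈ ends e) ∧ (∃ w, w ∉ U ∧ w ∈ ends e) ∧
    ((e ∈ F ∧ τ e = 2) ∨ (e ∉ F ∧ z e = true)))

/-- `u` is cut-attached relative to `B`: every vertex set containing `u` and avoiding `B` has its
cut configuration joining two of `a₁, a₂, a₃`. -/
def CutAttached (F : Finset E) (z : Config E) (τ : E → ℕ) (B : Set V) (u : V) : Prop :=
  ∀ U : Set V, u ∈ U → (∀ v ∈ B, v ∉ U) →
    Conn ends (cutCfg ends F z τ U) a₁ a₂ ∨ Conn ends (cutCfg ends F z τ U) a₁ a₃ ∨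
      Conn ends (cutCfg ends F z τ U) a₂ a₃

omit [Fintype E] [LinearOrder R] [IsStrictOrderedRing R] in
/-- An open edge of the cut configuration of the `specPin`-component of `u` is open in the
spectator. -/
lemma cutCfg_le_of_component (F : Finset E) (z : Config E) (τ : E → ℕ) (x : Config E) (u : V) :
    cutCfg ends F z τ {v | Conn ends (specPin F z τ x) u v} ≤ x := by
  intro e
  rw [Bool.le_iff_imp]
  intro he
  simp only [cutCfg, decide_eq_true_iff] at he
  obtain ⟨⟨v, hvU, hve⟩, ⟨w, hwU, hwe⟩, hforce⟩ := he
  by_contra hxe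
  have hxe' : x e = false := by
    cases h : x e
    · rfl
    · exact absurd h hxe
  have hpin : specPin F z τ x e = true := by
    rcases hforce with ⟨heF, hτe⟩ | ⟨heF, hze⟩
    · rw [specPin_of_mem heF, hxe', hτe]
      simp
    · rw [specPin_of_notMem heF, hze]
  have hvw : v ≠ w := fun h => hwU (h ▸ hvU)
  have hends : ends e = s(v, w) := (Sym2.mem_and_mem_iff hvw).1 ⟨hve, hwe⟩
  have hconn : Conn ends (specPin F z τ x) v w := conn_of_openAdj ⟨e, hpin, hends⟩
  exact hwU (conn_trans hvU hconn)

omit [Fintype E] [LinearOrder R] [IsStrictOrderedRing R] in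
/-- **The cut rule on a fibre**: in a spectator `x` with `Q ∧ PD`, a vertex cut-attached relative
to `B` is joined by the forced-open configuration to a vertex of `B`. -/
lemma conn_of_cutAttached (F : Finset E) (z : Config E) (τ : E → ℕ) (B : Set V) (u : V)
    (hcut : CutAttached ends a₁ a₂ a₃ F z τ B u) (x : Config E) (hQ : ¬ Conn ends x a₂ a₁)
    (h13 : ¬ Conn ends x a₁ a₃) (h23 : ¬ Conn ends x a₂ a₃) :
    ∃ v ∈ B, Conn ends (specPin F z τ x) u v := by
  by_contra h
  have h' : ∀ v ∈ B, v ∉ {v | Conn ends (specPin F z τ x) u v} := fun v hv hc => h ⟨v, hv, hc⟩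
  have hj := hcut {v | Conn ends (specPin F z τ x) u v} (conn_refl _ _ _) h'
  have hle := cutCfg_le_of_component ends F z τ x u
  rcases hj with hj | hj | hj
  · exact hQ (conn_symm (conn_mono hle hj))
  · exact h13 (conn_mono hle hj)
  · exact h23 (conn_mono hle hj)

omit [Fintype E] [LinearOrder R] [IsStrictOrderedRing R] in
/-- `a₃` cut-attached relative to the roots is attached in every PD spectator's forced-open
configuration (the hypothesis `H3` of `blocks'''`). -/
lemma a3_attached_of_cutAttached (F : Finset E) (z : Config E) (τ : E → ℕ)
    (h₃ : CutAttached ends a₁ a₂ a₃ F z τ {a₁, a₂} a₃) (x : Config E) (hQ : ¬ Conn ends x a₂ a₁)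
    (h13 : ¬ Conn ends x a₁ a₃) (h23 : ¬ Conn ends x a₂ a₃) :
    Conn ends (specPin F z τ x) a₃ a₁ ∨ Conn ends (specPin F z τ x) a₃ a₂ := by
  obtain ⟨v, hv, hconn⟩ := conn_of_cutAttached ends a₁ a₂ a₃ F z τ {a₁, a₂} a₃ h₃ x hQ h13 h23
  rcases hv with hv | hv
  · rw [hv] at hconn; exact Or.inl hconn
  · rw [hv] at hconn; exact Or.inr hconn

omit [Fintype E] [LinearOrder R] [IsStrictOrderedRing R] in
/-- Once `a₃` is cut-attached relative to the roots, a vertex cut-attached relative to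
`{a₁, a₂, a₃}` is attached in every PD spectator's forced-open configuration. -/
lemma attached_of_cutAttached (F : Finset E) (z : Config E) (τ : E → ℕ)
    (h₃ : CutAttached ends a₁ a₂ a₃ F z τ {a₁, a₂} a₃) (u : V)
    (hu : CutAttached ends a₁ a₂ a₃ F z τ {a₁, a₂, a₃} u) (x : Config E) (hQ : ¬ Conn ends x a₂ a₁)
    (h13 : ¬ Conn ends x a₁ a₃) (h23 : ¬ Conn ends x a₂ a₃) :
    Conn ends (specPin F z τ x) u a₁ ∨ Conn ends (specPin F z τ x) u a₂ := by
  obtain ⟨v, hv, hconn⟩ := conn_of_cutAttached ends a₁ a₂ a₃ F z τ {a₁, a₂, a₃} u hu x hQ h13 h23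
  rcases hv with hv | hv | hv
  · rw [hv] at hconn; exact Or.inl hconn
  · rw [hv] at hconn; exact Or.inr hconn
  · rw [hv] at hconn
    rcases a3_attached_of_cutAttached ends a₁ a₂ a₃ F z τ h₃ x hQ h13 h23 with h3 | h3
    · exact Or.inl (conn_trans hconn h3)
    · exact Or.inr (conn_trans hconn h3)

omit [Fintype E] [LinearOrder R] [IsStrictOrderedRing R] in
/-- The forced-open configuration of a spectator is closed on its free set. -/
lemma specPin_eq_false_of_mem_specFree (F : Finset E) (z : Config E) (τ : E → ℕ) (x : Config E)
    {e : E} (he : e ∈ specFree F τ x) : specPin F z τ x e = false := by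
  obtain ⟨heF, hτe⟩ := mem_specFree.1 he
  rw [specPin_of_mem heF, hτe]
  simp

omit [Fintype E] [LinearOrder R] [IsStrictOrderedRing R] in
/-- An edge of a spectator's fibre (free, or forced open) is live: typed, or pinned open. -/
lemma live_of_fibre (F : Finset E) (z : Config E) (τ : E → ℕ) (x : Config E) {e : E}
    (he : e ∈ specFree F τ x ∨ specPin F z τ x e = true) : e ∈ F ∨ z e = true := by
  rcases he with he | he
  · exact Or.inl (specFree_subset F τ x he)
  · by_cases heF : e ∈ F
    · exact Or.inl heF
    · rw [specPin_of_notMem heF] at he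
      exact Or.inr he

omit [Fintype E] [LinearOrder R] [IsStrictOrderedRing R] in
/-- **`{b}` is a block of the `b`-kind** on every PD spectator's fibre in which `b` is not attached,
as soon as every neighbour of `b` along a live edge is cut-attached. -/
lemma blockData_singleton_b (b : V) (F : Finset E) (z : Config E) (τ : E → ℕ)
    (hb₁ : b ≠ a₁) (hb₂ : b ≠ a₂)
    (h₃ : CutAttached ends a₁ a₂ a₃ F z τ {a₁, a₂} a₃)
    (hN : ∀ e, (e ∈ F ∨ z e = true) → ∀ u, ends e = s(b, u) → u ≠ b →
      CutAttached ends a₁ a₂ a₃ F z τ {a₁, a₂, a₃} u)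
    (x : Config E) (hQ : ¬ Conn ends x a₂ a₁) (h13 : ¬ Conn ends x a₁ a₃) (h23 : ¬ Conn ends x a₂ a₃)
    (hnb : ¬ (Conn ends (specPin F z τ x) b a₁ ∨ Conn ends (specPin F z τ x) b a₂)) :
    BlockData ends a₁ a₂ {b} (specFree F τ x) (specPin F z τ x) := by
  have hnb' : ¬ Conn ends (specPin F z τ x) b a₁ ∧ ¬ Conn ends (specPin F z τ x) b a₂ :=
    ⟨fun h => hnb (Or.inl h), fun h => hnb (Or.inr h)⟩
  refine ⟨fun e he => specPin_eq_false_of_mem_specFree F z τ x he, ?_, ?_, ?_, ?_⟩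
  · rw [Finset.mem_singleton]; exact fun h => hb₁ h.symm
  · rw [Finset.mem_singleton]; exact fun h => hb₂ h.symm
  · intro v hv
    rw [Finset.mem_singleton] at hv
    subst hv
    exact hnb'
  · intro e he v y hends hv hy
    rw [Finset.mem_singleton] at hv hy
    subst hv
    have hlive := live_of_fibre F z τ x he
    exact attached_of_cutAttached ends a₁ a₂ a₃ F z τ h₃ y (hN e hlive y hends hy) x hQ h13 h23

/-- **The class-level cut rule.** If `a₃` is cut-attached relative to the roots, and `b` or `o` is
cut-attached relative to `{a₁, a₂, a₃}` or every neighbour of `b` along a live edge is, then the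
typed count of `K₃` vanishes. -/
theorem typedCount_eq_zero_of_cutRule (o b : V) (F : Finset E) (z : Config E) (τ : E → ℕ)
    (hτ : ∀ e ∈ F, τ e = 1 ∨ τ e = 2) (hb₁ : b ≠ a₁) (hb₂ : b ≠ a₂) (hob : o ≠ b) (h3b : a₃ ≠ b)
    (h₃ : CutAttached ends a₁ a₂ a₃ F z τ {a₁, a₂} a₃)
    (hW : CutAttached ends a₁ a₂ a₃ F z τ {a₁, a₂, a₃} b ∨
      CutAttached ends a₁ a₂ a₃ F z τ {a₁, a₂, a₃} o ∨
      (∀ e, (e ∈ F ∨ z e = true) → ∀ u, ends e = s(b, u) → u ≠ b →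
        CutAttached ends a₁ a₂ a₃ F z τ {a₁, a₂, a₃} u)) :
    typedCount F z τ (K3 ends o a₁ a₂ a₃ b : Config E → Config E → Config E → R) = 0 := by
  refine typedCount_eq_zero_of_blocks''' ends o a₁ a₂ a₃ b F z τ hτ ?_ ?_
  · intro x _ hQ h13 h23
    exact a3_attached_of_cutAttached ends a₁ a₂ a₃ F z τ h₃ x hQ h13 h23
  · intro x _ hQ h13 h23
    rcases hW with hb | ho | hN
    · exact Or.inr (Or.inl (attached_of_cutAttached ends a₁ a₂ a₃ F z τ h₃ b hb x hQ h13 h23))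
    · exact Or.inr (Or.inr (Or.inl (attached_of_cutAttached ends a₁ a₂ a₃ F z τ h₃ o ho x hQ h13 h23)))
    · by_cases hbatt : Conn ends (specPin F z τ x) b a₁ ∨ Conn ends (specPin F z τ x) b a₂
      · exact Or.inr (Or.inl hbatt)
      · refine Or.inl ⟨{b}, blockData_singleton_b ends a₁ a₂ a₃ b F z τ hb₁ hb₂ h₃ hN x hQ h13 h23 hbatt,
          Or.inl ⟨Finset.mem_singleton_self b, ?_, ?_⟩⟩
        · rw [Finset.mem_singleton]; exact hob
        · rw [Finset.mem_singleton]; exact h3b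

end CutRule

end LocusBridge

end CovForm

end Summit.Ventures.PercRepro2
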